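import Summits.CriticalPhenomena.PercolationContinuityZ3.Theorems.PercNearOneGluingNoHeavyQuantRootScaledHeavyRoots
import Summits.CriticalPhenomena.PercolationContinuityZ3.Theorems.PercNearOneGluingNoHeavyQuantGluedPairMix
import Summits.CriticalPhenomena.PercolationContinuityZ3.Theorems.PercNearOneGluingNoHeavyQuantSiblingStepAtoms
import Summits.CriticalPhenomena.PercolationContinuityZ3.Theorems.PercNearOneGluingNoHeavyQuantJointBlobHull
import Summits.CriticalPhenomena.PercolationContinuityZ3.Theorems.PercNearOneGluingNoHeavyQuantDECAtLimit
import HarnessLib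

/-!
# QUANT lane R8, T-DEC: FORESTS OF IDENTICAL HEAVY-ROOTED GLUED SIBLINGS `(R^A[q](R^B[s]))^k` ARE SDEC AT THEIR FLOOR WHENEVER
# `k·q·(A + B·s) ≤ 4A` — in particular THE TIED GLUED LINE `(R²[q](R s))³` of README V422 at EVERY floor `qs ≤ 2/3` (unconditionally:
# no oracle, no hull certificate; arm-1 gen 49, architect)

builds on p205010 (kernel theorem, internal audit signed; external expert review pending)

Support + definition file (`--supports stmt-CriticalPhenomena-4575`), QUANT lane seat prim-quant-arm-1 (gen 49, architect), rung R8 of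
`run/shared/lean/prim/quant/LADDER.md`; memo `run/shared/lean/prim/quant/prim-quant-arm-1-g49/ARCH-G49.md` §2.  One definition (`gluedSib`, the lane's
glued-root sibling as `LawDec.Sib` data); theorems with standard axioms, no sorries.  Applies `…QuantRootScaledHeavyRoots` (`sdec_flaw_heavyRoots`: equal
root gates, SDEC sub-forest laws vanishing below `R`, `fmean ≤ 4R` ⟹ SDEC) to the explicit family; the sub-forest law `slice δ_A B s = δ_A ∗ gate δ_B s`
is SDEC by `sdec_blobLaw` (`…QuantJointBlobHull`), tree-built by `treeBuiltN_point` (`…QuantSiblingStepAtoms`), and the supremum floor `qs` is attained by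
`sdec_of_forall_lt` (`…QuantDECAtLimit`).

THE FAMILY.  The glued-root sibling `R^A[q](R^B[s])` (a root of gate `q` carrying `A ≥ 1` relays, one child of gate `0 < s < 1` carrying `B ≥ 1` relays;
`…QuantGluedPairMix`) has sub-forest law `ρ = slice δ_A B s = (1−s)·δ_A + s·δ_{A+B}` — SURE PART `A` (`ρ` vanishes below `A`), mean `A + Bs`, least
marginal `s`, one nontrivial gate, not a point mass.  A forest of `k` such siblings with a common root gate has `fmean = k·q·(A + Bs)`, so part 5's regime
reads `k·q·(A + Bs) ≤ 4A`:
* **`sdec_gluedForest_lt`** / **`sdec_gluedForest`**: `1 ≤ A`, `1 ≤ B`, `0 < q < 1`, `0 < s < 1`, `k·q·(A + Bs) ≤ 4A` ⟹ the forest law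
  `flaw (replicate k (gluedSib A B q s s))` is `SDEC x (k(A+B))` at every floor `0 < x < qs`, hence at `x = qs` (its least marginal);
* **`sdec_tiedGluedTriple`**: the tied glued line `(R²[q](R s))³` — `A = 2`, `B = 1`, `k = 3`, `3q(2+s) ≤ 8` automatic for `qs ≤ 2/3` — is
  `SDEC (qs) 9` for EVERY `0 < q < 1`, `0 < s < 1` with `qs ≤ 2/3`: README V422's named minimal open family of the light core ('near-tied glued-root
  triples', hull-irreducible for `q(2+s) > 2` by `…QuantGluedPairMix`, the tied core of V425's E6 and of census-1 g23 / census-2 g73's maps) is FREE in the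
  kernel at every light floor and every outer gate, with no count-level certificate: its residual charges only atoms `≥ 4 ≥ (3q(2+s))/2`;
* **`sdec_gluedTriple_heavyRoot`**: any `(R^A[q](R^B[s]))³` with `3q(A + Bs) ≤ 4A`.
NOT covered (honest): census-2's regression witness `(R¹[q](R²[s]))³` (`A = 1`: `6q(1+2s)·… `, i.e. `3q(1+2s) ≤ 4` fails at `q = .95`, `s = 1/2`; its
residual charges the low atom `2`), the tied line at width `k ≥ 4` beyond `kq(2+s) ≤ 8`, unequal root gates.

* `gluedSib` and its facts (`gluedSib_rho_apply`, `gluedSib_rho_eq_blobLaw`, `gluedSib_treeBuiltN`, `gluedSib_treeOK`, `gluedSib_sdec`, `gluedSib_mean`,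
  `gluedSib_rho_below`); `ftop_replicate`, `fmean_replicate`, `flaw_replicate_gluedSib`;
* **`sdec_gluedForest_lt`**, **`sdec_gluedForest`**, **`sdec_gluedTriple_heavyRoot`**, **`sdec_tiedGluedTriple`**.

HONEST STATUS: an explicit SDEC family (the list form of `SiblingStep` holds on it with the oracle discharged); `SiblingStep`, `GateStepN`, `FarTreeRow`
OPEN; RATE class log\* / honest sentence of `run/shared/lean/prim/quant/README.md` unchanged.  [this work]; glued pair vocabulary: prim-quant-lead g46;
blob SDEC: prim-quant-stmt g40 / census-2 g53; DEC limits: this lane.  Nothing here is cited as a published result.  The gluing rows served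
[cite: KozmaNitzan2024, Conjecture 3 (p. 15)]; product measure [cite: Grimmett1999, §1.3 p. 10].
-/

noncomputable section

open scoped BigOperators

namespace Summit.CriticalPhenomena.PercolationContinuityZ3.Theorems
namespace Quant
namespace LawDec

open Finset

/-- the point mass `δ_K` -/
local notation3 "δ[" K "]" => (fun k : ℕ => if k = (K : ℕ) then (1 : ℝ) else 0)

/-! ### The glued-root sibling as sibling data -/

/-- **the glued-root sibling `R^A[q](R^B[s])` as `Sib` data**: root gate `q`, sub-forest law `slice δ_A B s = δ_A ∗ gate δ_B s` on `{0..A+B}` with one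
nontrivial gate, recorded sub-forest floor `x₁` (a tree-built floor of the sub-forest is any `x₁ < s`; the law-level functionals ignore it). [this work] -/
def gluedSib (A B : ℕ) (q s x₁ : ℝ) : Sib := ⟨q, x₁, 1, A + B, slice δ[A] B s⟩

/-- the fields of `gluedSib`. [this work] -/
theorem gluedSib_fields (A B : ℕ) (q s x₁ : ℝ) :
    (gluedSib A B q s x₁).q = q ∧ (gluedSib A B q s x₁).x₁ = x₁ ∧ (gluedSib A B q s x₁).n = 1 ∧ (gluedSib A B q s x₁).M = A + B ∧
      (gluedSib A B q s x₁).ρ = slice δ[A] B s :=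
  ⟨rfl, rfl, rfl, rfl, rfl⟩

/-- **the sub-forest law pointwise**: `slice δ_A B s = (1−s)·δ_A + s·δ_{A+B}` (`A, B ≥ 1`). [this work] -/
theorem gluedSib_rho_apply (A B : ℕ) (hA : 1 ≤ A) (hB : 1 ≤ B) (s : ℝ) (h : ℕ) :
    slice δ[A] B s h = (if h = A then 1 - s else 0) + (if h = A + B then s else 0) := by
  have e := gluedPair_apply 1 s A B h hA hB
  rw [gate_one] at e
  rw [e]
  split_ifs <;> ring

/-- the sure blob: `slice δ₀ A 1 = δ_A`. [this work] -/
theorem slice_delta_zero_one (A : ℕ) : slice δ[0] A 1 = δ[A] := by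
  funext h
  simp only [slice]
  by_cases h1 : A ≤ h
  · rw [if_pos h1]
    by_cases h2 : h = A
    · rw [if_pos (show h - A = 0 by omega), if_pos h2]; ring
    · rw [if_neg (show ¬ (h - A = 0) by omega), if_neg h2]; ring
  · rw [if_neg h1, if_neg (show ¬ (h = A) by omega)]; ring

/-- **the sub-forest law is the blob law `blobLaw [(B, s), (A, 1)]`** (a sure `A`-blob sliced by a `B`-blob of gate `s`). [this work] -/
theorem gluedSib_rho_eq_blobLaw (A B : ℕ) (s : ℝ) : blobLaw [(B, s), (A, 1)] = slice δ[A] B s := by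
  show slice (slice (blobLaw []) A 1) B s = slice δ[A] B s
  rw [show blobLaw [] = δ[0] from rfl, slice_delta_zero_one]

/-- **the sub-forest law is tree-built with one nontrivial gate at every floor `s·y`, `0 < y < 1`** (`δ_A ∗ gate δ_B s`, `0 < s < 1`). [this work] -/
theorem gluedSib_treeBuiltN (A B : ℕ) {s y : ℝ} (hs0 : 0 < s) (hs1 : s < 1) (hy0 : 0 < y) (hy1 : y < 1) :
    TreeBuiltN (s * y) 1 (A + B) (slice δ[A] B s) := by
  have hsy0 : 0 < s * y := mul_pos hs0 hy0
  have hsy1 : s * y < 1 := by nlinarith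
  have h1 : TreeBuiltN (s * y) 0 A δ[A] := treeBuiltN_point A hsy0 hsy1
  have h2 : TreeBuiltN (s * y) (0 + 1) B (gate δ[B] s) := TreeBuiltN.gate s hs0 hs1 (treeBuiltN_point B hy0 hy1)
  have h3 := TreeBuiltN.conv h1 h2
  rw [gluedPair_eq_slice s A B] at h3
  simpa using h3

/-- **the sub-forest law vanishes below the sure part `A`.** [this work] -/
theorem gluedSib_rho_below (A B : ℕ) (hA : 1 ≤ A) (hB : 1 ≤ B) (s : ℝ) (h : ℕ) (hh : h < A) : slice δ[A] B s h = 0 := by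
  rw [gluedSib_rho_apply A B hA hB s h, if_neg (by omega), if_neg (by omega)]; ring

/-- **the sub-forest law is not a point mass** (`0 < s < 1`: the atom `A` carries `1 − s ∈ (0,1)`). [this work] -/
theorem gluedSib_rho_ne_point (A B : ℕ) (hA : 1 ≤ A) (hB : 1 ≤ B) {s : ℝ} (hs0 : 0 < s) (hs1 : s < 1) (K : ℕ) :
    slice δ[A] B s ≠ δ[K] := by
  intro hK
  have e := congrFun hK A
  rw [gluedSib_rho_apply A B hA hB s A, if_pos rfl, if_neg (by omega), add_zero] at e
  by_cases hAK : A = K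
  · rw [if_pos hAK] at e; linarith
  · rw [if_neg hAK] at e; linarith

/-- **the sub-forest law is SDEC at every floor `0 < x₁ < 1` with `x₁ ≤ s`** (`sdec_blobLaw` on `[(B, s), (A, 1)]`). [this work] -/
theorem gluedSib_sdec (A B : ℕ) {s x₁ : ℝ} (hx0 : 0 < x₁) (hx1 : x₁ < 1) (hxs : x₁ ≤ s) (hs1 : s ≤ 1) :
    SDEC x₁ (A + B) (slice δ[A] B s) := by
  have h := sdec_blobLaw x₁ hx0 hx1 [(B, s), (A, 1)] (fun p hp => by
    rcases List.mem_cons.1 hp with rfl | hp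
    · exact ⟨hxs, hs1⟩
    · rw [List.mem_singleton] at hp
      subst hp
      exact ⟨hx1.le, le_rfl⟩)
  rw [gluedSib_rho_eq_blobLaw] at h
  simpa [blobTop] using h

/-- **the mean of the sub-forest law is `A + B·s`.** [this work] -/
theorem gluedSib_mean (A B : ℕ) (q s x₁ : ℝ) : (gluedSib A B q s x₁).mean = (A : ℝ) + (B : ℝ) * s := by
  show ∑ h ∈ Finset.range (A + B + 1), (h : ℝ) * slice δ[A] B s h = (A : ℝ) + (B : ℝ) * s
  rw [sum_mul_slice δ[A] B s A (fun h hh => if_neg (by omega)) (by simp [Finset.sum_ite_eq', Finset.mem_range])]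
  have e : ∀ h : ℕ, (h : ℝ) * (if h = A then (1 : ℝ) else 0) = if h = A then (A : ℝ) else 0 := by
    intro h; split_ifs with hh
    · rw [hh, mul_one]
    · rw [mul_zero]
  rw [Finset.sum_congr rfl fun h _ => e h, Finset.sum_ite_eq' (Finset.range (A + 1)) A (fun _ => (A : ℝ)), if_pos (by simp)]

/-- **the glued sibling is tree-built sibling data at floor `x`** whenever `x ≤ q·(s·y)` with the recorded floor `s·y`, `0 < y < 1`, `0 < q < 1`,
`0 < s < 1`, `A, B ≥ 1`. [this work] -/
theorem gluedSib_treeOK (A B : ℕ) (hA : 1 ≤ A) (hB : 1 ≤ B) {q s y x : ℝ} (hq0 : 0 < q) (hq1 : q < 1) (hs0 : 0 < s) (hs1 : s < 1)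
    (hy0 : 0 < y) (hy1 : y < 1) (hx : x ≤ q * (s * y)) : (gluedSib A B q s (s * y)).TreeOK x :=
  ⟨hq0, hq1, hx, gluedSib_treeBuiltN A B hs0 hs1 hy0 hy1, gluedSib_rho_ne_point A B hA hB hs0 hs1⟩

/-! ### Replicated lists -/

/-- top of a replicated list. [this work] -/
theorem ftop_replicate (k : ℕ) (g : Sib) : ftop (List.replicate k g) = k * g.M := by
  induction k with
  | zero => simp [ftop]
  | succ k ih => rw [List.replicate_succ]; simp only [ftop, ih]; ring

/-- mean of a replicated list. [this work] -/
theorem fmean_replicate (k : ℕ) (g : Sib) : fmean (List.replicate k g) = (k : ℝ) * (g.q * g.mean) := by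
  induction k with
  | zero => simp [fmean]
  | succ k ih => rw [List.replicate_succ]; simp only [fmean, ih]; push_cast; ring

/-- the forest law of a replicated glued sibling does not depend on the recorded sub-forest floor. [this work] -/
theorem flaw_replicate_gluedSib (k A B : ℕ) (q s x₁ x₁' : ℝ) :
    flaw (List.replicate k (gluedSib A B q s x₁)) = flaw (List.replicate k (gluedSib A B q s x₁')) := by
  induction k with
  | zero => rfl
  | succ k ih =>
    rw [List.replicate_succ, List.replicate_succ]
    simp only [flaw]
    rw [ih, ftop_replicate, ftop_replicate]
    rfl

/-! ### The family is SDEC -/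

/-- **FORESTS OF IDENTICAL HEAVY-ROOTED GLUED SIBLINGS ARE SDEC below their least marginal**: `A, B ≥ 1`, `0 < q < 1`, `0 < s < 1`,
`k·q·(A + B·s) ≤ 4A`, and any floor `0 < x < q·s`: the forest law of `k` copies of `R^A[q](R^B[s])` is `SDEC x (k(A+B))` — `sdec_flaw_heavyRoots` with
`R = A` (the residual charges only atoms `≥ 2A ≥ fmean/2`), the sub-forest laws SDEC by `sdec_blobLaw`; NO oracle. [this work] -/
theorem sdec_gluedForest_lt (k A B : ℕ) (hA : 1 ≤ A) (hB : 1 ≤ B) {q s : ℝ} (hq0 : 0 < q) (hq1 : q < 1) (hs0 : 0 < s) (hs1 : s < 1)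
    (hreg : (k : ℝ) * (q * ((A : ℝ) + (B : ℝ) * s)) ≤ 4 * (A : ℝ)) {x : ℝ} (hx0 : 0 < x) (hx : x < q * s) :
    SDEC x (k * (A + B)) (flaw (List.replicate k (gluedSib A B q s s))) := by
  have hqs0 : 0 < q * s := mul_pos hq0 hs0
  have hqs1 : q * s < 1 := by nlinarith
  have hx1 : x < 1 := hx.trans hqs1
  -- the recorded floor `s·y` with `x = q·(s·y)`
  set y : ℝ := x / (q * s) with hy
  have hy0 : 0 < y := div_pos hx0 hqs0
  have hy1 : y < 1 := (div_lt_one hqs0).2 hx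
  have hxy : x ≤ q * (s * y) := by
    rw [hy, ← mul_assoc, mul_div_cancel₀ _ hqs0.ne']
  set g : Sib := gluedSib A B q s (s * y) with hg
  have hT : g.TreeOK x := gluedSib_treeOK A B hA hB hq0 hq1 hs0 hs1 hy0 hy1 hxy
  have hmem : ∀ t ∈ List.replicate k g, t = g := fun t ht => List.eq_of_mem_replicate ht
  have hL : ∀ t ∈ List.replicate k g, t.TreeOK x := fun t ht => by rw [hmem t ht]; exact hT
  have hq : ∀ t ∈ List.replicate k g, t.q = q := fun t ht => by rw [hmem t ht, hg]; rfl
  have hρ : ∀ t ∈ List.replicate k g, SDEC t.x₁ t.M t.ρ := fun t ht => by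
    rw [hmem t ht]
    show SDEC (s * y) (A + B) (slice δ[A] B s)
    exact gluedSib_sdec A B (mul_pos hs0 hy0) (by nlinarith) (by nlinarith) hs1.le
  have hR : ∀ t ∈ List.replicate k g, ∀ h, h < A → t.ρ h = 0 := fun t ht h hh => by
    rw [hmem t ht]
    exact gluedSib_rho_below A B hA hB s h hh
  have hheavy : fmean (List.replicate k g) ≤ 4 * (A : ℝ) := by
    rw [fmean_replicate, hg, gluedSib_mean]
    exact hreg
  have main := sdec_flaw_heavyRoots hx0 hx1 A (List.replicate k g) hL hq hρ hR hheavy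
  rw [ftop_replicate, hg, flaw_replicate_gluedSib k A B q s (s * y) s] at main
  exact main

/-- **… AND AT THEIR LEAST MARGINAL `qs`** (the supremum floor is attained, `sdec_of_forall_lt`). [this work] -/
theorem sdec_gluedForest (k A B : ℕ) (hA : 1 ≤ A) (hB : 1 ≤ B) {q s : ℝ} (hq0 : 0 < q) (hq1 : q < 1) (hs0 : 0 < s) (hs1 : s < 1)
    (hreg : (k : ℝ) * (q * ((A : ℝ) + (B : ℝ) * s)) ≤ 4 * (A : ℝ)) :
    SDEC (q * s) (k * (A + B)) (flaw (List.replicate k (gluedSib A B q s s))) := by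
  have hqs0 : 0 < q * s := mul_pos hq0 hs0
  have hqs1 : q * s < 1 := by nlinarith
  have hL : ∀ t ∈ List.replicate k (gluedSib A B q s s), t.LawOK := fun t ht => by
    rw [List.eq_of_mem_replicate ht]
    obtain ⟨_, _, ρ0, ρM, ρ1, _⟩ := (gluedSib_treeBuiltN A B hs0 hs1 (by norm_num : (0 : ℝ) < 1 / 2) (by norm_num)).lawFacts
    exact ⟨hq0, hq1, ρ0, ρM, ρ1⟩
  obtain ⟨_, fM, _, _⟩ := flaw_facts _ hL
  rw [ftop_replicate] at fM
  exact sdec_of_forall_lt hqs0 hqs1 fM (fun x hx0 hx => sdec_gluedForest_lt k A B hA hB hq0 hq1 hs0 hs1 hreg hx0 hx)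

/-- **GLUED TRIPLES WITH A HEAVY ROOT PART**: `(R^A[q](R^B[s]))³` with `3q(A + Bs) ≤ 4A` is `SDEC (qs) (3(A+B))`. [this work] -/
theorem sdec_gluedTriple_heavyRoot (A B : ℕ) (hA : 1 ≤ A) (hB : 1 ≤ B) {q s : ℝ} (hq0 : 0 < q) (hq1 : q < 1) (hs0 : 0 < s) (hs1 : s < 1)
    (hreg : 3 * (q * ((A : ℝ) + (B : ℝ) * s)) ≤ 4 * (A : ℝ)) :
    SDEC (q * s) (3 * (A + B)) (flaw [gluedSib A B q s s, gluedSib A B q s s, gluedSib A B q s s]) := by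
  have h := sdec_gluedForest 3 A B hA hB hq0 hq1 hs0 hs1 (by push_cast; linarith)
  simpa [List.replicate] using h

/-- **THE TIED GLUED LINE `(R²[q](R s))³` IS SDEC AT ITS FLOOR, FOR EVERY `0 < q < 1`, `0 < s < 1` WITH `qs ≤ 2/3`** (README V422's named minimal
open family of the light core; `3q(2+s) = 6q + 3qs < 8 = 4·2`): the forest law on `{0..9}` is `SDEC (qs) 9` — the list form of `SiblingStep` on this
family with the oracle discharged, no hull or count-level certificate. [this work] -/
theorem sdec_tiedGluedTriple {q s : ℝ} (hq0 : 0 < q) (hq1 : q < 1) (hs0 : 0 < s) (hs1 : s < 1) (hqs : q * s ≤ 2 / 3) :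
    SDEC (q * s) 9 (flaw [gluedSib 2 1 q s s, gluedSib 2 1 q s s, gluedSib 2 1 q s s]) := by
  have hreg : 3 * (q * (((2 : ℕ) : ℝ) + ((1 : ℕ) : ℝ) * s)) ≤ 4 * ((2 : ℕ) : ℝ) := by
    push_cast; nlinarith
  have h := sdec_gluedTriple_heavyRoot 2 1 (by norm_num) le_rfl hq0 hq1 hs0 hs1 hreg
  simpa using h


end LawDec
end Quant
end Summit.CriticalPhenomena.PercolationContinuityZ3.Theorems
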